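import Summits.BirchSwinnertonDyer.Rank1Residual.TwoVariableOrdinaryMainConjecture
import Literature.NumberTheory.EllipticCurves.BurungaleCastellaSkinner2025.GreenbergMuInvariantProofs
import Literature.NumberTheory.EllipticCurves.Rubin1991.TwoVariableCMLines
import HarnessLib

/-!
# The GREENBERG two-variable Iwasawa main conjecture for `E/K` over the `ℤ_p²`-extension
# ("`(L_p^Gr(E/K)) = ch_{Λ_K}(X_Gr(E/K_∞))` in `Λ_K^ur`"; Burungale–Castella–Skinner 2025, statement
# 4.1.2 = Yan–Zhu 2026, statement 4.1 (2)) — TYPED as an obligation leaf (`@[conjecture]`, nothing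
# asserted), with BCS Thm. 4.1.3 ("4.1.1 ⟺ 4.1.2") as PROVED edges modulo the typed Beilinson–Flach
# equivalence

STAGED by the cross-ladder literature-typing layer (cell `bsd-littype`, seat 03, gen 4; D-0088(4);
sheet `staging/bsd-littype-03/SHEETS-03.md` §7).  Companion of `TwoVariableOrdinaryMainConjecture.lean`
(same directory, gen 3: the ORDINARY statement 4.1.1 as `OrdinaryTwoVariableMainConjectureAt`, which
recorded 4.1.2 as "NOT typed: no carrier for `L_p^Gr`").  The carrier now exists — `IsGreenbergLFunction₂`
(`YanZhu2026/GreenbergMainTheorems.lean`, seat `bsd-littype-04` gen 3: `𝓛_p^Gr := h_K·𝓛_𝔭(K)'·𝓛_p^II`,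
[CGS25, Def. 2.4.3] = [YZ26, Def. 3.11], receptacle `𝒪_{ℂ_p}⟦T₁⟧⟦T₂⟧ ⊇ Λ_K^ur`, analytic frames read
at the INVERSE generators — orientation (O1)–(O4) of `Rubin1991/TwoVariableMainConjecture.lean`) with
the named facts `YanZhu2026.thm42_XGr₂_isTorsion_charIdeal_le_greenberg` (Thm. 4.2 (2) + (Im): proves
4.1 (2) on a locus) and `YanZhu2026.thm47_ord_localised_iff_greenberg_localised` (Thm. 4.7 = BCS
Thm. 4.1.3 = [BSTW, Prop. 9.18]: the EQUIVALENCE of the ordinary and Greenberg divisibilities).  This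
file files statement 4.1.2 in EXACTLY that currency and PROVES BCS's "In particular, Conjecture 4.1.1
and Conjecture 4.1.2 are equivalent" modulo the typed equivalence fact.  Conjectures are not Literature
(CONVENTIONS §4), hence a Summits leaf; HONEST FRAMING (cell): "typed ≠ proved ≠ endorsed".  (The
CGS-side carrier `CastellaGrossiSkinner2025.IsGreenbergLFunction` of seat `bsd-littype-02` — product
frame over a conjugate Katz frame — types the same printed object with another bookkeeping; the two
carriers are not bridged in the tree; this file uses the YZ26 one, whose facts it consumes.)

## The printed statements

A. Burungale, F. Castella, C. Skinner, *Base change and Iwasawa main conjectures for GL₂*, IMRN 2025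
rnaf082 = arXiv:2405.00270v2, §4.1, p. 8 (`[corpus: paper:arxiv-2405.00270 p0008 L15–L51]`):

> **4.1.2.** Let `g ∈ S₂(Γ₀(N))` be a newform and `p > 2` a prime of good reduction for `g`. Let
> `K` be an imaginary quadratic field satisfying (spl). Then `X_Gr(g/K_∞)` is `Λ_K`-torsion, with
> `(L_p^Gr(g/K)) = ch_{Λ_K}(X_Gr(g/K_∞))` as ideals in `Λ_K^ur`.
> The central result of [BSTW23] is the existence of two-variable zeta element for `E` over `K`,
> which leads to the following useful equivalence between the preceding two-variable main
> conjectures of different nature.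
> **Theorem 4.1.3.** Let `g ∈ S₂(Γ₀(N))` be an elliptic newform, and `p ∤ 2N` an ordinary prime for
> `g`. Let `K` be an imaginary quadratic field satisfying (spl), `(D_K, N) = 1`, and (irr_K). Then the
> following are equivalent: (i) `X_ord(g/K_∞)` is `Λ_K`-torsion, with
> `(L_p^PR(g/K)) ⊃ ch_{Λ_K}(X_ord(g/K_∞))` in `Λ_K ⊗ ℚ_p`. (ii) `X_Gr(g/K_∞)` is `Λ_K`-torsion, with
> `(L_p^Gr(g/K)) ⊃ ch_{Λ_K}(X_Gr(g/K_∞))` in `Λ_K^ur ⊗ ℚ_p`.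
> The same conclusion holds for the opposite divisibilities, and before inverting `p`. In particular,
> Conjecture 4.1.1 and Conjecture 4.1.2 are equivalent.
> *Proof.* This is shown in [BSTW23, §9.3.2] (cf. [CGS23, Prop. 3.2.1] or [Cas24, §3.3]) building on
> a pair of four-term exact sequences coming from Poitou–Tate duality. □

with (p. 7, `[p0007 L52–L60]`) the standing assumption of §4 "(irr_K): `ρ̄_g` is irreducible as
`G_K`-representation, where `K = M` is imaginary quadratic in this section" and "We refer the reader
to §§1.2 and 1.4 of [CGS23] for … `L_p^Gr(g/K) ∈ Λ_K^ur`".  X. Yan, X. Zhu, J. Algebra **693** (2026)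
= arXiv:2412.20078v4, §4.1 statement 4.1 (2) (l.923–927): "`𝒳_{𝓕_Gr}(E/K_∞)` is `Λ_K`-torsion and
`Char_{Λ_K}(𝒳_{𝓕_Gr}(E/K_∞))Λ_K^ur = (𝓛_p^Gr(E/K))`"; Thm. 4.2 (2) + (Im) (l.932–949) proves it under
the Heegner hypothesis and absolute irreducibility; Thm. 4.7 (l.1022–1034) is the `S`-localised
equivalence of the ORDINARY and GREENBERG divisibilities in both directions.  STATUS IN PRINT: OPEN as
printed outside those loci (no Heegner hypothesis; (irr_K) without (Im); supersingular `p`).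

## Transcription (tree vocabulary only; every carrier cited by name, none re-declared)

Exactly that of `YanZhu2026.thm42_XGr₂_isTorsion_charIdeal_le_greenberg` ((T1)–(T8) of its module
docstring): `E = W/ℚ` globally minimal with newform `f`; `(p) = v v̄` in `K` with `v` induced by `ι`;
`Γ_K` through THE (cyclotomic, anticyclotomic) pair `(κ₁, κ₂)` with an adapted generator pair
`(γ₁, γ₂)`, `Λ_K = IwasawaAlgebra₂ p`; `X_Gr(E/K_∞) = (W.baseChange K).XGr₂ p κ₁ κ₂ v̄ γ₁ γ₂`;
`L_p^Gr(E/K) = G` characterised by `IsGreenbergLFunction₂ ι v v̄ κ₁ κ₂ γ₁⁻¹ γ₂⁻¹ f |D_K| h_K LK G` over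
a Katz frame `LK`; "`Char(X)Λ_K^ur = (𝓛)`" = equality of `charIdeal.map (toUnr₂ p J)` with `span {G}`
along every structure-compatible `J : ℤ_p → 𝒪_{ℂ_p}`.  The sentence `bcs2025_statement_4_1_2` carries
`YanZhu2026.GreenbergSetting` (good ORDINARY `p > 2` — print: "good reduction" —, (spl), `(N, D_K) = 1`,
(disc), (cyc, anti)) and §4's standing (irr_K): WEAKER than print (special case), `E`-case.
-- TODO(general form): newforms `g` with arbitrary coefficient field; supersingular good `p`; drop (disc)/(N, D_K) = 1 once `L_p^Gr` has a carrier outside the [CGS25, §2]/[YZ26, §2–§3] setting.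

## What this file declares

* `GreenbergTwoVariableMainConjectureAt ι W K v v̄ κ₁ κ₂ γ₁ γ₂ f` — the statement AT a datum (literally
  the (Im)-conclusion shape of `thm42_XGr₂_…`); `bcs2025_statement_4_1_2` — the printed sentence.  Both
  `@[conjecture]`; nothing asserted.
* PROVED edges (kernel bookkeeping): (1) `of_yanZhu_thm42_of_bigIm` (YZ Thm. 4.2 (2) + (Im) ⟹ the
  statement at a datum); (2) `isTorsion`, `charIdeal_map_eq_span`, `exists_frame_hasUnitContent_minus`
  (with the PROVED `μ`-transfer of `GreenbergMuInvariantProofs.lean`: BCS Prop. 4.2.2); (3) **BCS Thm.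
  4.1.3 modulo `YanZhu2026.thm47_…`**: `charIdeal_map_eq_span_of_ordinaryAt`,
  `ordinary_inclusions_of_greenbergAt`, `of_ordinaryAt`, `ordinaryAt_of` (the `X_ord`-torsion clause
  discharged by the flag-free `YanZhu2026.cor29_XOrd₂_isTorsion`), `ordinaryAt_iff_greenbergAt` — Thm.
  4.7 AS TYPED transports the divisibilities, not the torsion-ness of `X_Gr`, which is therefore a
  hypothesis of `of_ordinaryAt`; (4) `at_of_statement`; (5) `exists_ringHom_padicInt_padicComplexInt`
  (a compatible `J : ℤ_p → 𝒪_{ℂ_p}` EXISTS, so the facts' "`∀ J`" clauses are not vacuous).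
Consumers: two-variable cells (BSTW §9–10, X10b; LADDER-BSD K3/D1), planners wanting a
`--conditional-on` leaf for the Greenberg two-variable IMC, littype-04's Cor. 5.4 / Lemma 2.6 glue.

## References
* [BurungaleCastellaSkinner2025] IMRN 2025 rnaf082 = arXiv:2405.00270v2: §4.1 statements 4.1.1/4.1.2,
  Thm. 4.1.3, Cor. 4.1.4 (p. 8); §4 standing (irr_K) (p. 7); Prop. 4.2.2 (p. 9).
* [YanZhu2024MainConjNonCM] J. Algebra 693 (2026) = arXiv:2412.20078v4: statement 4.1 (2) (l.923–927),
  Thm. 4.2 (2) (l.932–949), Thm. 4.7 (l.1022–1034), Def. 3.11, Cor. 2.9.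
* [CastellaGrossiSkinner2025] Math. Ann. 393 (2025): Def. 2.4.3 (`L_p^Gr`), Prop. 4.2.1.
* [BurungaleSkinnerTianWan2024] arXiv:2409.01350, §9.3.2 / Prop. 9.18 (the printed proof of Thm. 4.1.3).
-/

noncomputable section

open scoped Classical

open PowerSeries NumberField IsDedekindDomain Field CongruenceSubgroup
  Literature.NumberTheory.GaloisRepresentations Literature.NumberTheory.EllipticCurves
  Literature.NumberTheory.EllipticCurves.ModularForms Literature.NumberTheory.EllipticCurves.Rank1Residual
  Literature.NumberTheory.EllipticCurves.IwasawaAlgebra₂ Literature.NumberTheory.EllipticCurves.UnrSeries₂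
  Literature.NumberTheory.EllipticCurves.GreenbergVatsal2000
  Literature.NumberTheory.EllipticCurves.BurungaleCastellaSkinner2025
  Literature.NumberTheory.EllipticCurves.YanZhu2026

namespace Summit.BirchSwinnertonDyer.Rank1Residual.TwoVariableIMC

/-- **The Greenberg two-variable main conjecture AT a datum — TYPED** (Burungale–Castella–Skinner
2025 statement 4.1.2 = Yan–Zhu 2026 statement 4.1 (2), `E`-case): for `E = W/ℚ` with newform `f`,
the field `K` with `(p) = v v̄`, `Γ_K` through `(κ₁, κ₂; γ₁, γ₂)` and an embedding datum `ι`: "there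
are Katz–de Shalit period data `(Ω ≠ 0, δ² = ±D_K, Ω_p ∈ R₀ˣ)`, a series `LK` which IS `𝓛_𝔭(K)`
(`IsKatzMeasure₂ …` at `(γ₁⁻¹, γ₂⁻¹)`) and a series `G` which IS `L_p^Gr(E/K)` (`IsGreenbergLFunction₂`),
such that `X = X_Gr(E/K_∞) = XGr₂ … v̄` is `Λ_K`-torsion and `ch_{Λ_K}(X)·Λ_K^ur = (L_p^Gr(E/K))`"
(equality of the extended ideal with `(G)` along every structure-compatible `J : ℤ_p → 𝒪_{ℂ_p}`).
LITERALLY the (Im)-conclusion of `YanZhu2026.thm42_XGr₂_isTorsion_charIdeal_le_greenberg`.  A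
predicate; nothing asserted; OPEN in general (known locus: edge (1) below).
[cite: BurungaleCastellaSkinner2025, statement 4.1.2 (§4.1, p. 8 of arXiv:2405.00270v2) with §4 standing hypotheses (p. 7)]
[cite: YanZhu2024MainConjNonCM, statement 4.1 (2) (arXiv:2412.20078v4 TeX l.923–927) with Def. 3.11 (l.865–871)] -/
@[conjecture] def GreenbergTwoVariableMainConjectureAt {p : ℕ} [Fact p.Prime] (ι : PadicAlgCl p ≃+* ℂ)
    (W : WeierstrassCurve ℚ) [W.IsElliptic] [W.IsGloballyMinimal] (K : Type) [Field K] [NumberField K]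
    (v vbar : HeightOneSpectrum (𝓞 K)) (κ₁ κ₂ : ZpExtension K p) (γ₁ γ₂ : absoluteGaloisGroup K)
    [Fact (ZpExtension.IsTopGeneratorPair κ₁ κ₂ γ₁ γ₂)] {N : ℕ} [NeZero N]
    (f : CuspForm (Gamma0 N) 2) [NeZero (NumberField.discr K).natAbs] : Prop :=
  ∃ (Ω δ : ℂ) (Ωp : (unrIntegers p)ˣ) (LK G : PowerSeries (PowerSeries (PadicComplexInt p))),
    Ω ≠ 0 ∧ (δ ^ 2 = (NumberField.discr K : ℂ) ∨ δ ^ 2 = -(NumberField.discr K : ℂ)) ∧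
    IsKatzMeasure₂ ι v vbar ∅ κ₁ κ₂ γ₁⁻¹ γ₂⁻¹ 1 Ω δ ((Ωp : unrIntegers p) : ℂ_[p]) LK ∧
    IsGreenbergLFunction₂ ι v vbar κ₁ κ₂ γ₁⁻¹ γ₂⁻¹ f (NumberField.discr K).natAbs
      (NumberField.classNumber K) LK G ∧
    Module.IsTorsion (IwasawaAlgebra₂ p) ((W.baseChange K).XGr₂ p κ₁ κ₂ vbar γ₁ γ₂) ∧
    ∀ J : ℤ_[p] →+* PadicComplexInt p,
      (∀ x : ℤ_[p], ((J x : PadicComplexInt p) : ℂ_[p]) = ((x : ℚ_[p]) : ℂ_[p])) →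
      (WeierstrassCurve.XGr₂.charIdeal (W.baseChange K) p κ₁ κ₂ vbar γ₁ γ₂).map (toUnr₂ p J) =
        Ideal.span {G}

/-- **Burungale–Castella–Skinner 2025, statement 4.1.2 (§4.1, p. 8), `E`-case, verbatim**: "Let
`g ∈ S₂(Γ₀(N))` be a newform and `p > 2` a prime of good reduction for `g`. Let `K` be an imaginary
quadratic field satisfying (spl). Then `X_Gr(g/K_∞)` is `Λ_K`-torsion, with
`(L_p^Gr(g/K)) = ch_{Λ_K}(X_Gr(g/K_∞))` as ideals in `Λ_K^ur`."  Transcribed for `g = f_E` under the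
standing data of the carrier (`YanZhu2026.GreenbergSetting`: good ORDINARY `p > 2` split in `K` with
`v` induced by `ι`, `(N, D_K) = 1`, (disc), `(κ₁, κ₂)` = (cyc, anti)) and §4's standing (irr_K) —
WEAKER than print (special case).  A statement STATED, and proved on a locus, by the source; nothing
asserted here.
-- TODO(general form): arbitrary newforms `g`; supersingular good `p`; drop (disc)/(N, D_K) = 1 once `L_p^Gr` has a carrier outside the [CGS25, §2]/[YZ26, §2–§3] setting.
[cite: BurungaleCastellaSkinner2025, statement 4.1.2 (§4.1, p. 8 of arXiv:2405.00270v2) with (irr_K) (p. 7)]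
[cite: YanZhu2024MainConjNonCM, statement 4.1 (2) (arXiv:2412.20078v4 TeX l.923–927) with §4.1 setting (l.909–915)] -/
@[conjecture] def bcs2025_statement_4_1_2 : Prop :=
  ∀ {p : ℕ} [Fact p.Prime] (ι : PadicAlgCl p ≃+* ℂ) (W : WeierstrassCurve ℚ) [W.IsElliptic]
    [W.IsGloballyMinimal] (K : Type) [Field K] [NumberField K] (v vbar : HeightOneSpectrum (𝓞 K))
    (κ₁ κ₂ : ZpExtension K p) (γ₁ γ₂ : absoluteGaloisGroup K)
    [Fact (ZpExtension.IsTopGeneratorPair κ₁ κ₂ γ₁ γ₂)] {N : ℕ} [NeZero N] {f : CuspForm (Gamma0 N) 2}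
    (_ : IsNewformOf W f) [NeZero (NumberField.discr K).natAbs],
    GreenbergSetting ι W N K v vbar κ₁ κ₂ → (W.baseChange K).HasIrreducibleModPGaloisRep p →
    GreenbergTwoVariableMainConjectureAt ι W K v vbar κ₁ κ₂ γ₁ γ₂ f

namespace Greenberg

variable {p : ℕ} [Fact p.Prime] {K : Type} [Field K] [NumberField K]

/-! ### (0) A structure-compatible `J : ℤ_p → 𝒪_{ℂ_p}` exists — PROVED -/

/-- **A ring map `J : ℤ_p → 𝒪_{ℂ_p}` compatible with `ℤ_p ⊂ ℚ_p ⊂ ℂ_p`** (the map along which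
"`Char_{Λ_K}(𝒳) Λ_K^ur`" is the extended ideal in the named facts; (T1) of the carrier file): the
composite `ℤ_p → ℚ_p → ℚ̄_p → ℂ_p` lands in the valuation ring (`‖x‖ ≤ 1`).  So the clauses
"for every structure-compatible `J`" of the facts and of the leaf are never vacuous.
[cite: YanZhu2024MainConjNonCM, statement 4.1 (2) ("Char_{Λ_K}(𝒳_{𝓕_Gr}(E/K_∞))Λ_K^ur", arXiv:2412.20078v4 TeX l.923–927) and §3.4 l.851 (Λ_K^ur := Λ_K ⊗̂ ℤ_p^ur)] -/
theorem exists_ringHom_padicInt_padicComplexInt :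
    ∃ J : ℤ_[p] →+* PadicComplexInt p,
      ∀ x : ℤ_[p], ((J x : PadicComplexInt p) : ℂ_[p]) = ((x : ℚ_[p]) : ℂ_[p]) := by
  set F : ℤ_[p] →+* ℂ_[p] :=
    (algebraMap (PadicAlgCl p) ℂ_[p]).comp ((algebraMap ℚ_[p] (PadicAlgCl p)).comp PadicInt.Coe.ringHom)
    with hF
  have hFx : ∀ x : ℤ_[p], F x = ((x : ℚ_[p]) : ℂ_[p]) := fun x ↦ rfl
  have hmem : ∀ x : ℤ_[p], F x ∈ PadicComplexInt p := fun x ↦ by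
    rw [mem_padicComplexInt_iff, hFx, PadicComplex.norm_extends']
    exact x.norm_le_one
  exact ⟨F.codRestrict (PadicComplexInt p) hmem, fun x ↦ hFx x⟩

/-! ### (1) Yan–Zhu Thm. 4.2 (2) + (Im) ⟹ the statement at `(E, K, p)` — PROVED -/

/-- **Yan–Zhu 2026 Thm. 4.2 (2) with its (Im) clause gives statement 4.1.2 at `(E, K, p)`** on its
locus: the Greenberg standing data, Heegner hypothesis, `ρ̄_E|_{G_K}` absolutely irreducible, and
(Im) (`BigIm W p`). [cite: YanZhu2024MainConjNonCM, Thm. 4.2 (2) and the (Im) clause (arXiv:2412.20078v4 TeX l.932–949)]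
[cite: BurungaleCastellaSkinner2025, statement 4.1.2 (§4.1, p. 8 of arXiv:2405.00270v2)] -/
theorem of_yanZhu_thm42_of_bigIm (h : thm42_XGr₂_isTorsion_charIdeal_le_greenberg)
    (ι : PadicAlgCl p ≃+* ℂ) (W : WeierstrassCurve ℚ) [W.IsElliptic] [W.IsGloballyMinimal]
    (v vbar : HeightOneSpectrum (𝓞 K)) (κ₁ κ₂ : ZpExtension K p) (γ₁ γ₂ : absoluteGaloisGroup K)
    [Fact (ZpExtension.IsTopGeneratorPair κ₁ κ₂ γ₁ γ₂)] {N : ℕ} [NeZero N]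
    {f : CuspForm (Gamma0 N) 2} (hf : IsNewformOf W f) [NeZero (NumberField.discr K).natAbs]
    (hS : GreenbergSetting ι W N K v vbar κ₁ κ₂) (hHeeg : SatisfiesHeegnerHypothesis N K)
    (habs : ∀ ρ : ModPGaloisRep K (ZMod p) 2, (W.baseChange K).IsTorsionGaloisRep p ρ →
      FramedRep.IsAbsolutelyIrreducible ρ) (hIm : BigIm W p) :
    GreenbergTwoVariableMainConjectureAt ι W K v vbar κ₁ κ₂ γ₁ γ₂ f := by
  obtain ⟨Ω, δ, Ωp, LK, G, hΩ, hδ, hLK, hG, htor, hJ⟩ := h ι W K v vbar κ₁ κ₂ γ₁ γ₂ hf hS hHeeg habs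
  exact ⟨Ω, δ, Ωp, LK, G, hΩ, hδ, hLK, hG, htor, fun J hJc ↦ (hJ J hJc).2 hIm⟩

/-! ### (2) Consequences AT a datum — PROVED -/

section Consequences

variable {ι : PadicAlgCl p ≃+* ℂ} {W : WeierstrassCurve ℚ} [W.IsElliptic] [W.IsGloballyMinimal]
  {v vbar : HeightOneSpectrum (𝓞 K)} {κ₁ κ₂ : ZpExtension K p} {γ₁ γ₂ : absoluteGaloisGroup K}
  [Fact (ZpExtension.IsTopGeneratorPair κ₁ κ₂ γ₁ γ₂)] {N : ℕ} [NeZero N] {f : CuspForm (Gamma0 N) 2}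
  [NeZero (NumberField.discr K).natAbs]

/-- The statement at a datum gives: `X_Gr(E/K_∞)` is `Λ_K`-torsion.
[cite: BurungaleCastellaSkinner2025, statement 4.1.2 (torsion clause, p. 8 of arXiv:2405.00270v2)] -/
theorem isTorsion (h : GreenbergTwoVariableMainConjectureAt ι W K v vbar κ₁ κ₂ γ₁ γ₂ f) :
    Module.IsTorsion (IwasawaAlgebra₂ p) ((W.baseChange K).XGr₂ p κ₁ κ₂ vbar γ₁ γ₂) := by
  obtain ⟨-, -, -, -, -, -, -, -, -, htor, -⟩ := h
  exact htor

/-- The statement at a datum gives the equality `ch(X_Gr)·𝒪_{ℂ_p}⟦T₁,T₂⟧ = (L_p^Gr)` for SOME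
Katz/Greenberg frame and EVERY compatible structure map.
[cite: BurungaleCastellaSkinner2025, statement 4.1.2 (p. 8 of arXiv:2405.00270v2)]
[cite: YanZhu2024MainConjNonCM, statement 4.1 (2) (arXiv:2412.20078v4 TeX l.923–927)] -/
theorem charIdeal_map_eq_span (h : GreenbergTwoVariableMainConjectureAt ι W K v vbar κ₁ κ₂ γ₁ γ₂ f) :
    ∃ (Ω δ : ℂ) (Ωp : (unrIntegers p)ˣ) (LK G : PowerSeries (PowerSeries (PadicComplexInt p))),
      IsKatzMeasure₂ ι v vbar ∅ κ₁ κ₂ γ₁⁻¹ γ₂⁻¹ 1 Ω δ ((Ωp : unrIntegers p) : ℂ_[p]) LK ∧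
      IsGreenbergLFunction₂ ι v vbar κ₁ κ₂ γ₁⁻¹ γ₂⁻¹ f (NumberField.discr K).natAbs
        (NumberField.classNumber K) LK G ∧
      ∀ J : ℤ_[p] →+* PadicComplexInt p,
        (∀ x : ℤ_[p], ((J x : PadicComplexInt p) : ℂ_[p]) = ((x : ℚ_[p]) : ℂ_[p])) →
        (WeierstrassCurve.XGr₂.charIdeal (W.baseChange K) p κ₁ κ₂ vbar γ₁ γ₂).map (toUnr₂ p J) =
          Ideal.span {G} := by
  obtain ⟨Ω, δ, Ωp, LK, G, -, -, hLK, hG, -, hJ⟩ := h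
  exact ⟨Ω, δ, Ωp, LK, G, hLK, hG, hJ⟩

/-- **`μ(L_p^Gr) = 0` for the conjecture's own frame** (BCS Prop. 4.2.2, `L_p^Gr` half, through the
PROVED transfer `hasUnitContent_minus_of_prop314_of_prop422` of `GreenbergMuInvariantProofs.lean`):
granted the comparison fact `prop314_…` and the BDP half `prop422_…`, under the Greenberg standing
data, (Heeg) and (irr_K), the statement at a datum yields a frame `(LK, G)` for which BOTH
`ch(X_Gr)·𝒪_{ℂ_p}⟦T₁,T₂⟧ = (G)` AND `μ(G⁻) = 0` (some coefficient of `G(0,T₂)` is a unit).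
[cite: BurungaleCastellaSkinner2025, Prop. 4.2.2 and statement 4.1.2 (pp. 8–9 of arXiv:2405.00270v2)] -/
theorem exists_frame_hasUnitContent_minus (h : GreenbergTwoVariableMainConjectureAt ι W K v vbar κ₁ κ₂ γ₁ γ₂ f)
    (h314 : prop314_span_minus_eq_span_bdp) (h422 : prop422_exists_isBDPLFunction_mu_eq_zero)
    (hf : IsNewformOf W f) (hS : GreenbergSetting ι W N K v vbar κ₁ κ₂)
    (hHeeg : SatisfiesHeegnerHypothesis N K) (hirrK : (W.baseChange K).HasIrreducibleModPGaloisRep p) :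
    ∃ (Ω δ : ℂ) (Ωp : (unrIntegers p)ˣ) (LK G : PowerSeries (PowerSeries (PadicComplexInt p))),
      IsKatzMeasure₂ ι v vbar ∅ κ₁ κ₂ γ₁⁻¹ γ₂⁻¹ 1 Ω δ ((Ωp : unrIntegers p) : ℂ_[p]) LK ∧
      IsGreenbergLFunction₂ ι v vbar κ₁ κ₂ γ₁⁻¹ γ₂⁻¹ f (NumberField.discr K).natAbs
        (NumberField.classNumber K) LK G ∧
      HasUnitContent (minus G) ∧
      ∀ J : ℤ_[p] →+* PadicComplexInt p,
        (∀ x : ℤ_[p], ((J x : PadicComplexInt p) : ℂ_[p]) = ((x : ℚ_[p]) : ℂ_[p])) →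
        (WeierstrassCurve.XGr₂.charIdeal (W.baseChange K) p κ₁ κ₂ vbar γ₁ γ₂).map (toUnr₂ p J) =
          Ideal.span {G} := by
  obtain ⟨Ω, δ, Ωp, LK, G, -, -, hLK, hG, -, hJ⟩ := h
  exact ⟨Ω, δ, Ωp, LK, G, hLK, hG, hasUnitContent_minus_of_prop314_of_prop422 h314 h422 ι W K v vbar
    κ₁ κ₂ γ₁ γ₂ hf hS hHeeg hirrK hLK hG, hJ⟩

end Consequences

/-! ### (3) BCS Theorem 4.1.3 — "Conjecture 4.1.1 and Conjecture 4.1.2 are equivalent" — as PROVED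
edges modulo the typed two-variable equivalence `YanZhu2026.thm47_…` -/

section Thm413

variable (ι₁ : integralClosure ℚ ℂ →+* ℂ_[p]) (ι : PadicAlgCl p ≃+* ℂ) (W : WeierstrassCurve ℚ)
  [W.IsElliptic] [W.IsGloballyMinimal] (v vbar : HeightOneSpectrum (𝓞 K)) (κ₁ κ₂ : ZpExtension K p)
  (γ₁ γ₂ : absoluteGaloisGroup K) [Fact (ZpExtension.IsTopGeneratorPair κ₁ κ₂ γ₁ γ₂)] {N : ℕ}
  [NeZero N] (π : ModularParametrizationData W N) [NeZero (NumberField.discr K).natAbs]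

/-- **BCS Thm. 4.1.3, (i) ⟹ (ii) on the characteristic ideals ("before inverting `p`", both
divisibilities): statement 4.1.1 at a datum gives the Greenberg EQUALITY
`ch(X_Gr)·𝒪_{ℂ_p}⟦T₁,T₂⟧ = (L_p^Gr)` for EVERY Katz/Greenberg frame `(LK, G)` of `f_E` and every
compatible `J`** — granted the typed equivalence `thm47_…` (YZ Thm. 4.7 with `S = {1}`, both
directions; hypotheses: Greenberg standing data, (irr_K), `ι₁` compatible with `ι`).  The printed
"four-term exact sequences coming from Poitou–Tate duality" are inside the named fact.
[cite: BurungaleCastellaSkinner2025, Thm. 4.1.3 and its proof (§4.1, p. 8 of arXiv:2405.00270v2)]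
[cite: YanZhu2024MainConjNonCM, Thm. 4.7 with S = {1} (arXiv:2412.20078v4 TeX l.1022–1034, l.1036–1050)] -/
theorem charIdeal_map_eq_span_of_ordinaryAt (h47 : thm47_ord_localised_iff_greenberg_localised)
    (hS : GreenbergSetting ι W N K v vbar κ₁ κ₂) (hirrK : (W.baseChange K).HasIrreducibleModPGaloisRep p)
    (hι : ∀ z : integralClosure ℚ ℂ, ι₁ z = ((ι.symm (z : ℂ) : PadicAlgCl p) : ℂ_[p]))
    (hord : OrdinaryTwoVariableMainConjectureAt ι₁ W K κ₁ κ₂ γ₁ γ₂ π)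
    {Ω δ : ℂ} {Ωp : (unrIntegers p)ˣ} {LK G : PowerSeries (PowerSeries (PadicComplexInt p))}
    (hLK : IsKatzMeasure₂ ι v vbar ∅ κ₁ κ₂ γ₁⁻¹ γ₂⁻¹ 1 Ω δ ((Ωp : unrIntegers p) : ℂ_[p]) LK)
    (hG : IsGreenbergLFunction₂ ι v vbar κ₁ κ₂ γ₁⁻¹ γ₂⁻¹ π.f (NumberField.discr K).natAbs
      (NumberField.classNumber K) LK G)
    {J : ℤ_[p] →+* PadicComplexInt p}
    (hJ : ∀ x : ℤ_[p], ((J x : PadicComplexInt p) : ℂ_[p]) = ((x : ℚ_[p]) : ℂ_[p])) :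
    (WeierstrassCurve.XGr₂.charIdeal (W.baseChange K) p κ₁ κ₂ vbar γ₁ γ₂).map (toUnr₂ p J) =
      Ideal.span {G} := by
  obtain ⟨F, hF, hc, -, hle, hge⟩ := hord
  obtain ⟨h1, h2⟩ := h47 ι₁ ι W K v vbar κ₁ κ₂ γ₁ γ₂ π hS hirrK hι F hF hc Ω δ Ωp LK G hLK hG J hJ 1
    one_ne_zero
  have hle' := h1.mp (hle.away 1)
  have hge' := h2.mp (hge.away 1)
  rw [map_one, exists_span_one_pow_mul_le_iff] at hle' hge'
  exact le_antisymm hle' hge'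

/-- **BCS Thm. 4.1.3, (ii) ⟹ (i) on the characteristic ideals: statement 4.1.2 at a datum gives BOTH
ORDINARY inclusions `ch(X_ord) ⊂ (L_p^PR)` and `(L_p^PR) ⊂ ch(X_ord)` in `Λ_K` for EVERY type-I frame
`F = 𝓛_p(f_E/K, Σ^{(1)})`** (`IsHidaRankinLFunction ι₁ … π.f F ∧ IsCongruenceIntegral π.f F`,
`L_p^PR = perrinRiouLFunction W π F`) — granted `thm47_…`, under the Greenberg standing data, (irr_K)
and `ι₁` compatible with `ι`.  (Uses a compatible `J`, which exists: `exists_ringHom_padicInt_padicComplexInt`.)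
[cite: BurungaleCastellaSkinner2025, Thm. 4.1.3 and its proof (§4.1, p. 8 of arXiv:2405.00270v2)]
[cite: YanZhu2024MainConjNonCM, Thm. 4.7 with S = {1} (arXiv:2412.20078v4 TeX l.1022–1034)] -/
theorem ordinary_inclusions_of_greenbergAt (h47 : thm47_ord_localised_iff_greenberg_localised)
    (hS : GreenbergSetting ι W N K v vbar κ₁ κ₂) (hirrK : (W.baseChange K).HasIrreducibleModPGaloisRep p)
    (hι : ∀ z : integralClosure ℚ ℂ, ι₁ z = ((ι.symm (z : ℂ) : PadicAlgCl p) : ℂ_[p]))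
    (hgr : GreenbergTwoVariableMainConjectureAt ι W K v vbar κ₁ κ₂ γ₁ γ₂ π.f) {F : CycAntiSeries p}
    (hF : IsHidaRankinLFunction ι₁ W κ₁ κ₂ π.f F) (hc : IsCongruenceIntegral π.f F) :
    IdealLeSpan (WeierstrassCurve.XOrd₂.charIdeal (W.baseChange K) p κ₁ κ₂ γ₁ γ₂)
        (perrinRiouLFunction W π F) ∧
      SpanLeIdeal (perrinRiouLFunction W π F)
        (WeierstrassCurve.XOrd₂.charIdeal (W.baseChange K) p κ₁ κ₂ γ₁ γ₂) := by
  obtain ⟨Ω, δ, Ωp, LK, G, -, -, hLK, hG, -, hJall⟩ := hgr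
  obtain ⟨J, hJ⟩ := exists_ringHom_padicInt_padicComplexInt (p := p)
  obtain ⟨h1, h2⟩ := h47 ι₁ ι W K v vbar κ₁ κ₂ γ₁ γ₂ π hS hirrK hι F hF hc Ω δ Ωp LK G hLK hG J hJ 1
    one_ne_zero
  have heq := hJall J hJ
  rw [map_one, exists_span_one_pow_mul_le_iff] at h1 h2
  exact ⟨idealLeSpanAway_one_iff.mp (h1.mpr heq.le), spanLeIdealAway_one_iff.mp (h2.mpr heq.ge)⟩

/-- **BCS Thm. 4.1.3, "Conjecture 4.1.1 ⟹ Conjecture 4.1.2" AT a datum** — granted the typed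
equivalence `thm47_…` and the existence of the Greenberg frame `thm39_def311_…`, with the torsion
clause of the Greenberg side supplied as a hypothesis (Thm. 4.7 as typed transports divisibilities,
not torsion-ness; print obtains `X_Gr` torsion from the same four-term sequences — on the Heegner
locus it is part of `thm42_XGr₂_…`).
[cite: BurungaleCastellaSkinner2025, Thm. 4.1.3 ("In particular, Conjecture 4.1.1 and Conjecture 4.1.2 are equivalent", §4.1, p. 8 of arXiv:2405.00270v2)]
[cite: YanZhu2024MainConjNonCM, Thm. 4.7 (arXiv:2412.20078v4 TeX l.1022–1034) with Def. 3.11 / Thm. 3.9–3.10 (frame existence, l.839–878)] -/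
theorem of_ordinaryAt (h47 : thm47_ord_localised_iff_greenberg_localised)
    (h39 : thm39_def311_exists_isGreenbergLFunction₂) (hS : GreenbergSetting ι W N K v vbar κ₁ κ₂)
    (hirrK : (W.baseChange K).HasIrreducibleModPGaloisRep p)
    (hι : ∀ z : integralClosure ℚ ℂ, ι₁ z = ((ι.symm (z : ℂ) : PadicAlgCl p) : ℂ_[p]))
    (htor : Module.IsTorsion (IwasawaAlgebra₂ p) ((W.baseChange K).XGr₂ p κ₁ κ₂ vbar γ₁ γ₂))
    (hord : OrdinaryTwoVariableMainConjectureAt ι₁ W K κ₁ κ₂ γ₁ γ₂ π) :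
    GreenbergTwoVariableMainConjectureAt ι W K v vbar κ₁ κ₂ γ₁ γ₂ π.f := by
  obtain ⟨Ω, δ, Ωp, LK, G, hΩ, hδ, hLK, hG⟩ := h39 ι W K v vbar κ₁ κ₂ γ₁ γ₂ π.isNewformOf hS
  exact ⟨Ω, δ, Ωp, LK, G, hΩ, hδ, hLK, hG, htor, fun J hJ ↦
    charIdeal_map_eq_span_of_ordinaryAt ι₁ ι W v vbar κ₁ κ₂ γ₁ γ₂ π h47 hS hirrK hι hord hLK hG hJ⟩

/-- **BCS Thm. 4.1.3, "Conjecture 4.1.2 ⟹ Conjecture 4.1.1" AT a datum** — granted the typed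
equivalence `thm47_…`, a type-I frame `F` of `f_E` (print: [CGS23, Thm. 1.2.1] — typed as the
hypotheses `IsHidaRankinLFunction … F`, `IsCongruenceIntegral π.f F`), and the torsion clause of the
ordinary side DISCHARGED by the flag-free named fact `YanZhu2026.cor29_XOrd₂_isTorsion` (YZ Cor. 2.9:
`X_ord` is `Λ_K`-torsion at an odd good ordinary split prime under (irr_K), `(N_E, D_K) = 1`).
[cite: BurungaleCastellaSkinner2025, Thm. 4.1.3 ("In particular, Conjecture 4.1.1 and Conjecture 4.1.2 are equivalent", §4.1, p. 8 of arXiv:2405.00270v2)]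
[cite: YanZhu2024MainConjNonCM, Thm. 4.7 (arXiv:2412.20078v4 TeX l.1022–1034) and Cor. 2.9 (l.628–633)] -/
theorem ordinaryAt_of (h47 : thm47_ord_localised_iff_greenberg_localised) (h29 : cor29_XOrd₂_isTorsion)
    (hS : GreenbergSetting ι W N K v vbar κ₁ κ₂) (hirrK : (W.baseChange K).HasIrreducibleModPGaloisRep p)
    (hι : ∀ z : integralClosure ℚ ℂ, ι₁ z = ((ι.symm (z : ℂ) : PadicAlgCl p) : ℂ_[p]))
    {F : CycAntiSeries p} (hF : IsHidaRankinLFunction ι₁ W κ₁ κ₂ π.f F) (hc : IsCongruenceIntegral π.f F)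
    (hgr : GreenbergTwoVariableMainConjectureAt ι W K v vbar κ₁ κ₂ γ₁ γ₂ π.f) :
    OrdinaryTwoVariableMainConjectureAt ι₁ W K κ₁ κ₂ γ₁ γ₂ π := by
  have hN : (N : ℤ) = W.conductorNorm ℤ := hS.level
  have htor : Module.IsTorsion (IwasawaAlgebra₂ p) ((W.baseChange K).XOrd₂ p κ₁ κ₂ γ₁ γ₂) :=
    h29 W K κ₁ κ₂ γ₁ γ₂ hS.three_le hS.goodOrd hS.isImaginaryQuadratic hS.split (hN ▸ hS.coprime) hirrK
  obtain ⟨hle, hge⟩ := ordinary_inclusions_of_greenbergAt ι₁ ι W v vbar κ₁ κ₂ γ₁ γ₂ π h47 hS hirrK hι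
    hgr hF hc
  exact ⟨F, hF, hc, htor, hle, hge⟩

/-- **BCS Thm. 4.1.3 "In particular" as an `iff` between the two leaves AT a datum**, on the locus
where the side conditions are in hand: granted `thm47_…` (the equivalence), `thm39_def311_…` (the
Greenberg frame), `cor29_…` (`X_ord` torsion) and a type-I frame `F` of `f_E`, and with `X_Gr`
torsion supplied: `4.1.1 at (E,K,p,π,ι₁) ⟺ 4.1.2 at (E,K,p,f_E,ι)`.
[cite: BurungaleCastellaSkinner2025, Thm. 4.1.3 ("In particular, Conjecture 4.1.1 and Conjecture 4.1.2 are equivalent", §4.1, p. 8 of arXiv:2405.00270v2)]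
[cite: YanZhu2024MainConjNonCM, Thm. 4.7 (arXiv:2412.20078v4 TeX l.1022–1034), Cor. 2.9, Def. 3.11] -/
theorem ordinaryAt_iff_greenbergAt (h47 : thm47_ord_localised_iff_greenberg_localised)
    (h39 : thm39_def311_exists_isGreenbergLFunction₂) (h29 : cor29_XOrd₂_isTorsion)
    (hS : GreenbergSetting ι W N K v vbar κ₁ κ₂) (hirrK : (W.baseChange K).HasIrreducibleModPGaloisRep p)
    (hι : ∀ z : integralClosure ℚ ℂ, ι₁ z = ((ι.symm (z : ℂ) : PadicAlgCl p) : ℂ_[p]))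
    {F : CycAntiSeries p} (hF : IsHidaRankinLFunction ι₁ W κ₁ κ₂ π.f F) (hc : IsCongruenceIntegral π.f F)
    (htorGr : Module.IsTorsion (IwasawaAlgebra₂ p) ((W.baseChange K).XGr₂ p κ₁ κ₂ vbar γ₁ γ₂)) :
    OrdinaryTwoVariableMainConjectureAt ι₁ W K κ₁ κ₂ γ₁ γ₂ π ↔
      GreenbergTwoVariableMainConjectureAt ι W K v vbar κ₁ κ₂ γ₁ γ₂ π.f :=
  ⟨of_ordinaryAt ι₁ ι W v vbar κ₁ κ₂ γ₁ γ₂ π h47 h39 hS hirrK hι htorGr,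
    ordinaryAt_of ι₁ ι W v vbar κ₁ κ₂ γ₁ γ₂ π h47 h29 hS hirrK hι hF hc⟩

end Thm413

/-! ### (4) The sentence specialises to the statement at a datum — PROVED -/

/-- Granted the printed sentence, the statement holds at every datum on its locus (Greenberg standing
data and (irr_K)). [cite: BurungaleCastellaSkinner2025, statement 4.1.2 (§4.1, p. 8 of arXiv:2405.00270v2)] -/
theorem at_of_statement (h : bcs2025_statement_4_1_2) (ι : PadicAlgCl p ≃+* ℂ) (W : WeierstrassCurve ℚ)
    [W.IsElliptic] [W.IsGloballyMinimal] (v vbar : HeightOneSpectrum (𝓞 K)) (κ₁ κ₂ : ZpExtension K p)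
    (γ₁ γ₂ : absoluteGaloisGroup K) [Fact (ZpExtension.IsTopGeneratorPair κ₁ κ₂ γ₁ γ₂)] {N : ℕ}
    [NeZero N] {f : CuspForm (Gamma0 N) 2} (hf : IsNewformOf W f) [NeZero (NumberField.discr K).natAbs]
    (hS : GreenbergSetting ι W N K v vbar κ₁ κ₂) (hirrK : (W.baseChange K).HasIrreducibleModPGaloisRep p) :
    GreenbergTwoVariableMainConjectureAt ι W K v vbar κ₁ κ₂ γ₁ γ₂ f :=
  h ι W K v vbar κ₁ κ₂ γ₁ γ₂ hf hS hirrK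

end Greenberg

end Summit.BirchSwinnertonDyer.Rank1Residual.TwoVariableIMC

end
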